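import Mathlib
import Literature.Analysis.FluidPDE.LerayProfileCalculus
import Literature.Analysis.FluidPDE.SteadyNSSolution
import Summits.NavierStokesRegularity.OSWSelfSimilar.TypeIIRadialCommutators
import Summits.NavierStokesRegularity.OSWSelfSimilar.TypeIIModulatedAnsatz
import HarnessLib
/-!
# The symmetry kernel of the steady inner-limit linearisation (zone Z1 TEMPLATE §T1.4-II (L1)–(L4), pressure-explicit
# form — kernel-checked)

HONEST FRAMING (cell ns-blowup GROUP B «PROFILE SEARCH», zone Z1 «Type-II log-modulated DSS ansatz for axisymmetric
Navier–Stokes — the template IS the deliverable»; D-0035/D-0074): part VI-b of the Z1 dictionary (parts I–V: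
`TypeIIModulationDictionary`, `TypeIIModulationLawClasses`, `TypeIIModulatedAnsatz`, `TypeIIModulatedEnergy`,
`TypeIIModulatedWeights`; VI-a: `TypeIIRadialCommutators`).

TEMPLATE (I-5 viii)/(L1)–(L4): a STEADY inner limit `W` with axial drift `ζ` solves
`νΔW − ζ·∇W − (W·∇)W − ∇P = 0`, `div W = 0`; its linearisation (TEMPLATE (L1), written here with the pressure
perturbation `ψ` EXPLICIT instead of Leray-projected) is `L_W(φ, ψ) := νΔφ − ζ·∇φ − [(φ·∇)W + (W·∇)φ] − ∇ψ`, and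
TEMPLATE (L4) records the exact identities obtained by differentiating the steady equation along its three symmetry
families (NS scaling — which carries the drift to `μζ` —, axial translation, Galilean boost). This file kernel-checks them,
for ANY finite-dimensional real inner product space `E` and any drift vector `ζ ∈ E` (the template's `ζ_∞ e_z`), as
pointwise identities (the commutators are part VI-a):

* `fderiv_steadyResidual_eq_zero` — the derivative of the (vanishing) steady residual vanishes;
* **(L4) scaling**: `L_W(ΛW, Λ₂P) = ζ·∇W` with `ΛW = W + (y·∇)W`, `Λ₂P = 2P + (y·∇)P`
  (`linearisedSteadyNS_scalingGenerator`; «NS scaling `W_μ(y) = μW(μy)` carries drift `μζ_∞`»);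
* **(L4) translation**: `L_W(∂ₕW, ∂ₕP) = 0` for every direction `h` (`linearisedSteadyNS_translationGenerator`; the
  template's `∂_zW ∈ ker L_W` is `h = e_z`);
* **(L4) boost**: `L_W(e, 0) = −e·∇W` for every constant field `e` (`linearisedSteadyNS_const`; no equation needed);
* **(L4) «hence `ΛW + ζ_∞e_z ∈ ker L_W` EXACTLY»**: `L_W(ΛW + ζ, Λ₂P) = 0` (`linearisedSteadyNS_scalingGenerator_add_drift`);
* the scaling generator is divergence free (`divergence_add_fderiv_apply_self_eq_zero`; `∂ₕW` is by the tree's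
  `VectorCalculus.IsDivFree.fderiv_apply`);
* the dictionary entry «steady with drift `ζ`» = «`W + ζ` is a steady Navier–Stokes solution» against the tree's
  `Literature.Analysis.FluidPDE.IsSteadyNSSolution` (`isSteadyNSSolution_add_const_iff`), and the three FINITE covariances
  read through it: scaling carries the drift to `μζ` (`steadyWithDrift_rescale`, by the tree's `IsSteadyNSSolution.rescale`),
  translation keeps it (`steadyWithDrift_comp_add_right`, `IsSteadyNSSolution.comp_add_right`), the boost `W ↦ W + c`
  changes it to `ζ − c` (`steadyWithDrift_boost`, re-association); `IsSteadyNSSolution.linearised_generators` reads the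
  two kernel identities off the structure.

**Nothing here is a statement that a Navier–Stokes solution blows up, or that a non-constant bounded steady `W` exists**
(TEMPLATE (I-4)/(I-5 viii): such a `W` would answer an OPEN Liouville problem): the identities hold for every smooth pair
`(W, P)` solving the steady-with-drift system, e.g. the constants. «violates: n/a — dictionary»; bears_on LADDER-NS N5/Z1 →
N1 linear core / N0⁻. Author: ns-blowup-profile-eng-1 g5, 2026-08-27.
-/

open Real Filter Topology Set InnerProductSpace
open scoped Laplacian RealInnerProductSpace ContDiff
open Literature.Analysis.FluidPDE

-- nested operator types (`E →L[ℝ] E →L[ℝ] E`)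
set_option maxSynthPendingDepth 4

namespace Summit.NavierStokesRegularity.OSWSelfSimilar
namespace TypeIIModulationDictionary

/-! ### 1. The generators in the kernel of the linearised steady-with-drift operator (TEMPLATE (L4)) -/

section Generators

variable {E : Type*} [NormedAddCommGroup E] [InnerProductSpace ℝ E] [FiniteDimensional ℝ E]
variable {ν : ℝ} {W : E → E} {P : E → ℝ} {ζ : E}

/-- **The derivative of the steady residual vanishes.** If `(W, P)` (`W ∈ C³`, `P ∈ C²`) solves the steady-with-drift
system `νΔW − ζ·∇W − (W·∇)W − ∇P = 0` everywhere, then for all `y, v`: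
`ν D(ΔW)(y)v − D(ζ·∇W)(y)v − D((W·∇)W)(y)v − D(∇P)(y)v = 0`. [new here — dictionary] -/
theorem fderiv_steadyResidual_eq_zero (hW : ContDiff ℝ 3 W) (hP : ContDiff ℝ 2 P)
    (hR : ∀ z, ν • (Δ W) z - fderiv ℝ W z ζ - fderiv ℝ W z (W z) - gradient P z = 0) (y v : E) :
    ν • fderiv ℝ (Δ W) y v - fderiv ℝ (fun z => fderiv ℝ W z ζ) y v
      - fderiv ℝ (fun z => fderiv ℝ W z (W z)) y v - fderiv ℝ (gradient P) y v = 0 := by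
  have hW2 : ContDiff ℝ 2 W := hW.of_le (by norm_num)
  have hΔd : DifferentiableAt ℝ (Δ W) y := ((contDiff_one_laplacian hW).differentiable one_ne_zero) y
  have hDζ : DifferentiableAt ℝ (fun z => fderiv ℝ W z ζ) y :=
    (((hW.fderiv_right (m := 2) le_rfl).clm_apply contDiff_const).differentiable two_ne_zero) y
  have hconv : DifferentiableAt ℝ (fun z => fderiv ℝ W z (W z)) y :=
    (((hW.fderiv_right (m := 2) le_rfl).clm_apply hW2).differentiable two_ne_zero) y
  have hgrad : DifferentiableAt ℝ (gradient P) y := by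
    have e : gradient P = (InnerProductSpace.toDual ℝ E).symm ∘ fderiv ℝ P := rfl
    rw [e]
    exact (InnerProductSpace.toDual ℝ E).symm.differentiable.differentiableAt.comp y
      (((hP.fderiv_right (m := 1) le_rfl).differentiable one_ne_zero) y)
  have h1 : HasFDerivAt (fun z => ν • (Δ W) z - fderiv ℝ W z ζ - fderiv ℝ W z (W z) - gradient P z)
      (ν • fderiv ℝ (Δ W) y - fderiv ℝ (fun z => fderiv ℝ W z ζ) y
        - fderiv ℝ (fun z => fderiv ℝ W z (W z)) y - fderiv ℝ (gradient P) y) y :=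
    (((hΔd.hasFDerivAt.const_smul ν).sub hDζ.hasFDerivAt).sub hconv.hasFDerivAt).sub hgrad.hasFDerivAt
  have hfun : (fun z => ν • (Δ W) z - fderiv ℝ W z ζ - fderiv ℝ W z (W z) - gradient P z) = fun _ => (0 : E) :=
    funext hR
  have h2 : HasFDerivAt (fun z => ν • (Δ W) z - fderiv ℝ W z ζ - fderiv ℝ W z (W z) - gradient P z)
      (0 : E →L[ℝ] E) y := by
    rw [hfun]
    exact hasFDerivAt_const (0 : E) y
  have h3 := congrArg (fun T : E →L[ℝ] E => T v) (h1.unique h2)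
  simpa only [sub_apply, smul_apply, zero_apply] using h3

/-- **TEMPLATE (L4), scaling: `L_W(ΛW, Λ₂P) = ζ·∇W`** — «NS scaling `W_μ(y) = μW(μy)` carries drift `μζ_∞`».
For `(W, P)` (`W ∈ C³`, `P ∈ C²`) solving `νΔW − ζ·∇W − (W·∇)W − ∇P = 0`, the scaling generator
`φ = ΛW := W + (y·∇)W` with pressure `ψ = Λ₂P := 2P + (y·∇)P` satisfies
`νΔφ − ζ·∇φ − [(φ·∇)W + (W·∇)φ] − ∇ψ = ζ·∇W` at every `y`. [new here — dictionary] -/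
theorem linearisedSteadyNS_scalingGenerator (hW : ContDiff ℝ 3 W) (hP : ContDiff ℝ 2 P)
    (hR : ∀ z, ν • (Δ W) z - fderiv ℝ W z ζ - fderiv ℝ W z (W z) - gradient P z = 0) (y : E) :
    ν • (Δ (fun z => W z + fderiv ℝ W z z)) y
      - fderiv ℝ (fun z => W z + fderiv ℝ W z z) y ζ
      - (fderiv ℝ W y (W y + fderiv ℝ W y y) + fderiv ℝ (fun z => W z + fderiv ℝ W z z) y (W y))
      - gradient (fun z => 2 * P z + fderiv ℝ P z z) y
      = fderiv ℝ W y ζ := by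
  have hW2 : ContDiff ℝ 2 W := hW.of_le (by norm_num)
  have hWd : DifferentiableAt ℝ W y := (hW2.differentiable two_ne_zero) y
  have hrad : ContDiff ℝ 2 (fun z => fderiv ℝ W z z) := (hW.fderiv_right (m := 2) le_rfl).clm_apply contDiff_id
  have hradd : DifferentiableAt ℝ (fun z => fderiv ℝ W z z) y := (hrad.differentiable two_ne_zero) y
  have hPd : DifferentiableAt ℝ P y := (hP.differentiable two_ne_zero) y
  have hPrad : DifferentiableAt ℝ (fun z => fderiv ℝ P z z) y :=
    (((hP.fderiv_right (m := 1) le_rfl).clm_apply contDiff_id).differentiable one_ne_zero) y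
  -- Laplacian of `ΛW`
  have hΔ : (Δ (fun z => W z + fderiv ℝ W z z)) y = (3 : ℝ) • (Δ W) y + fderiv ℝ (Δ W) y y := by
    rw [show (fun z => W z + fderiv ℝ W z z) = W + fun z => fderiv ℝ W z z from rfl,
      ContDiffAt.laplacian_add hW2.contDiffAt hrad.contDiffAt, laplacian_fderiv_apply_self hW y]
    module
  -- derivative of `ΛW`
  have hD : ∀ w : E, fderiv ℝ (fun z => W z + fderiv ℝ W z z) y w
      = (2 : ℝ) • fderiv ℝ W y w + fderiv ℝ (fun z => fderiv ℝ W z w) y y := by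
    intro w
    rw [fderiv_fun_add hWd hradd, add_apply, fderiv_fderiv_apply_self_apply hW2 y w, two_smul]
    abel
  -- gradient of `Λ₂P`
  have hG : gradient (fun z => 2 * P z + fderiv ℝ P z z) y = (3 : ℝ) • gradient P y + fderiv ℝ (gradient P) y y := by
    have e1 : gradient (fun z => 2 * P z + fderiv ℝ P z z) y
        = gradient (fun z => 2 * P z) y + gradient (fun z => fderiv ℝ P z z) y := by
      rw [gradient, fderiv_fun_add (hPd.const_mul 2) hPrad, map_add]; rfl
    have e2 : gradient (fun z => 2 * P z) y = (2 : ℝ) • gradient P y := by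
      rw [gradient, fderiv_const_mul hPd, map_smulₛₗ]; rfl
    rw [e1, e2, gradient_fderiv_apply_self hP y]
    module
  -- the convective pair
  have hC : fderiv ℝ W y (W y + fderiv ℝ W y y) + fderiv ℝ (fun z => W z + fderiv ℝ W z z) y (W y)
      = (3 : ℝ) • fderiv ℝ W y (W y) + fderiv ℝ (fun z => fderiv ℝ W z (W z)) y y := by
    rw [map_add, fderiv_fun_add hWd hradd, add_apply]
    have := convect_fderiv_apply_self_add hW2 y
    -- `DW(W) + DW(y·∇W) + DW(W) + D(y·∇W)(W) = 3 DW(W) + y·∇(DW(W))`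
    calc fderiv ℝ W y (W y) + fderiv ℝ W y (fderiv ℝ W y y) + (fderiv ℝ W y (W y)
          + fderiv ℝ (fun z => fderiv ℝ W z z) y (W y))
        = (2 : ℝ) • fderiv ℝ W y (W y) + (fderiv ℝ (fun z => fderiv ℝ W z z) y (W y)
          + fderiv ℝ W y (fderiv ℝ W y y)) := by rw [two_smul]; abel
      _ = (2 : ℝ) • fderiv ℝ W y (W y) + (fderiv ℝ (fun z => fderiv ℝ W z (W z)) y y + fderiv ℝ W y (W y)) := by
          rw [this]
      _ = (3 : ℝ) • fderiv ℝ W y (W y) + fderiv ℝ (fun z => fderiv ℝ W z (W z)) y y := by module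
  have h0 := fderiv_steadyResidual_eq_zero hW hP hR y y
  have hRy := hR y
  rw [hΔ, hD ζ, hC, hG]
  -- `3 R(y) + (y·∇)R(y) + ζ·∇W = ζ·∇W`
  have key : ν • ((3 : ℝ) • (Δ W) y + fderiv ℝ (Δ W) y y)
      - ((2 : ℝ) • fderiv ℝ W y ζ + fderiv ℝ (fun z => fderiv ℝ W z ζ) y y)
      - ((3 : ℝ) • fderiv ℝ W y (W y) + fderiv ℝ (fun z => fderiv ℝ W z (W z)) y y)
      - ((3 : ℝ) • gradient P y + fderiv ℝ (gradient P) y y)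
      = (3 : ℝ) • (ν • (Δ W) y - fderiv ℝ W y ζ - fderiv ℝ W y (W y) - gradient P y)
        + (ν • fderiv ℝ (Δ W) y y - fderiv ℝ (fun z => fderiv ℝ W z ζ) y y
            - fderiv ℝ (fun z => fderiv ℝ W z (W z)) y y - fderiv ℝ (gradient P) y y)
        + fderiv ℝ W y ζ := by module
  rw [key, hRy, h0, smul_zero, zero_add, zero_add]

/-- **TEMPLATE (L4), translation: `L_W(∂ₕW, ∂ₕP) = 0`** (the template's `∂_zW ∈ ker L_W` is `h = e_z`; every direction
`h` works for the whole-space system). For `(W, P)` (`W ∈ C³`, `P ∈ C²`) solving `νΔW − ζ·∇W − (W·∇)W − ∇P = 0`,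
`φ = ∂ₕW`, `ψ = ∂ₕP` satisfy `νΔφ − ζ·∇φ − [(φ·∇)W + (W·∇)φ] − ∇ψ = 0`. [new here — dictionary] -/
theorem linearisedSteadyNS_translationGenerator (hW : ContDiff ℝ 3 W) (hP : ContDiff ℝ 2 P)
    (hR : ∀ z, ν • (Δ W) z - fderiv ℝ W z ζ - fderiv ℝ W z (W z) - gradient P z = 0) (y h : E) :
    ν • (Δ (fun z => fderiv ℝ W z h)) y
      - fderiv ℝ (fun z => fderiv ℝ W z h) y ζ
      - (fderiv ℝ W y (fderiv ℝ W y h) + fderiv ℝ (fun z => fderiv ℝ W z h) y (W y))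
      - gradient (fun z => fderiv ℝ P z h) y
      = 0 := by
  have hW2 : ContDiff ℝ 2 W := hW.of_le (by norm_num)
  rw [laplacian_fderiv_apply_const hW y h, fderiv_fderiv_apply_const_comm hW2 y h ζ, add_comm,
    convect_fderiv_apply_const_add hW2 y h, gradient_fderiv_apply_const hP y h]
  exact fderiv_steadyResidual_eq_zero hW hP hR y h

/-- **TEMPLATE (L4), Galilean boost: `L_W(e, 0) = −e·∇W`** for every constant field `e` (no equation needed: `Δe = 0`,
`De = 0`, `∇0 = 0`). With `e = e_z` this is the template's `L_W(e_z) = −∂_zW`. [new here — dictionary] -/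
theorem linearisedSteadyNS_const (ν : ℝ) (W : E → E) (ζ e y : E) :
    ν • (Δ (fun _ : E => e)) y
      - fderiv ℝ (fun _ : E => e) y ζ
      - (fderiv ℝ W y e + fderiv ℝ (fun _ : E => e) y (W y))
      - gradient (fun _ : E => (0 : ℝ)) y
      = -(fderiv ℝ W y e) := by
  have hg : gradient (fun _ : E => (0 : ℝ)) y = 0 := by
    rw [gradient, fderiv_const_apply, map_zero]
  rw [laplacian_const_eq_zero, fderiv_const_apply, hg]
  simp

/-- **TEMPLATE (L4): «hence `ΛW + ζ_∞e_z ∈ ker L_W` EXACTLY» (scaling combined with the boost that restores the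
drift).** For `(W, P)` (`W ∈ C³`, `P ∈ C²`) solving `νΔW − ζ·∇W − (W·∇)W − ∇P = 0`, the field `φ = ΛW + ζ` with
pressure `ψ = Λ₂P` satisfies `νΔφ − ζ·∇φ − [(φ·∇)W + (W·∇)φ] − ∇ψ = 0`. [new here — dictionary] -/
theorem linearisedSteadyNS_scalingGenerator_add_drift (hW : ContDiff ℝ 3 W) (hP : ContDiff ℝ 2 P)
    (hR : ∀ z, ν • (Δ W) z - fderiv ℝ W z ζ - fderiv ℝ W z (W z) - gradient P z = 0) (y : E) :
    ν • (Δ (fun z => W z + fderiv ℝ W z z + ζ)) y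
      - fderiv ℝ (fun z => W z + fderiv ℝ W z z + ζ) y ζ
      - (fderiv ℝ W y (W y + fderiv ℝ W y y + ζ) + fderiv ℝ (fun z => W z + fderiv ℝ W z z + ζ) y (W y))
      - gradient (fun z => 2 * P z + fderiv ℝ P z z) y
      = 0 := by
  have hW2 : ContDiff ℝ 2 W := hW.of_le (by norm_num)
  have hrad : ContDiff ℝ 2 (fun z => W z + fderiv ℝ W z z) :=
    hW2.add ((hW.fderiv_right (m := 2) le_rfl).clm_apply contDiff_id)
  -- adding the constant `ζ` changes neither `Δ` nor `D`
  have hΔ : (Δ (fun z => W z + fderiv ℝ W z z + ζ)) y = (Δ (fun z => W z + fderiv ℝ W z z)) y := by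
    rw [show (fun z => W z + fderiv ℝ W z z + ζ) = (fun z => W z + fderiv ℝ W z z) + fun _ => ζ from rfl,
      ContDiffAt.laplacian_add hrad.contDiffAt contDiff_const.contDiffAt, laplacian_const_eq_zero, add_zero]
  have hD : fderiv ℝ (fun z => W z + fderiv ℝ W z z + ζ) y = fderiv ℝ (fun z => W z + fderiv ℝ W z z) y :=
    fderiv_add_const ζ
  rw [hΔ, hD, map_add (fderiv ℝ W y)]
  have h := linearisedSteadyNS_scalingGenerator hW hP hR y
  rw [← sub_eq_zero] at h
  rw [← h]
  abel

/-- **The scaling generator is divergence free**: `div ΛW = div W + (y·∇) div W + div W = 0` for a divergence-free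
`W ∈ C²` (the tree's `divergence_fderiv_apply_self_eq_zero` for the radial part). The translation generator `∂ₕW` is
divergence free by the tree's `VectorCalculus.IsDivFree.fderiv_apply`; constants trivially. [new here — dictionary] -/
theorem divergence_add_fderiv_apply_self_eq_zero (hW : ContDiff ℝ 2 W) (hdiv : VectorCalculus.IsDivFree W) (y : E) :
    VectorCalculus.divergence (fun z => W z + fderiv ℝ W z z) y = 0 := by
  have hWd : DifferentiableAt ℝ W y := (hW.differentiable two_ne_zero) y
  have hradd : DifferentiableAt ℝ (fun z => fderiv ℝ W z z) y :=
    ((((hW.fderiv_right (m := 1) le_rfl).clm_apply contDiff_id)).differentiable one_ne_zero) y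
  have h1 := hdiv y
  have h2 := divergence_fderiv_apply_self_eq_zero hW hdiv y
  simp only [VectorCalculus.divergence] at h1 h2 ⊢
  rw [fderiv_fun_add hWd hradd, ContinuousLinearMap.toLinearMap_add, map_add, h1, h2, add_zero]

end Generators

/-! ### 2. «Steady with drift `ζ`» against the tree's `IsSteadyNSSolution`, and the finite covariances -/

section Drift

variable {E : Type*} [NormedAddCommGroup E] [InnerProductSpace ℝ E] [FiniteDimensional ℝ E]
variable {ν : ℝ} {W : E → E} {P : E → ℝ} {ζ : E}

/-- **Dictionary: «`W` is a steady inner limit with drift `ζ`» (TEMPLATE (I-5 viii): `ζ∂_zW + (W·∇)W + ∇P = νΔW`,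
`div W = 0`) iff `W + ζ` is a steady Navier–Stokes solution in the sense of the tree's
`Literature.Analysis.FluidPDE.IsSteadyNSSolution ν 0`** (the Galilean frame in which the far field is at rest;
`((W + ζ)·∇)(W + ζ) = (W·∇)W + ζ·∇W`, `Δ(W + ζ) = ΔW`, `div(W + ζ) = div W`). [new here — dictionary] -/
theorem isSteadyNSSolution_add_const_iff :
    IsSteadyNSSolution ν 0 (fun y => W y + ζ) P ↔
      ContDiff ℝ 2 W ∧ ContDiff ℝ 1 P ∧
        (∀ z, ν • (Δ W) z - fderiv ℝ W z ζ - fderiv ℝ W z (W z) - gradient P z = 0) ∧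
        VectorCalculus.IsDivFree W := by
  -- smoothness of `W + ζ` versus `W`
  have hsm : ContDiff ℝ 2 (fun y => W y + ζ) ↔ ContDiff ℝ 2 W := by
    constructor
    · intro h
      have : W = fun y => (W y + ζ) - ζ := by funext y; simp
      rw [this]
      exact h.sub contDiff_const
    · intro h
      exact h.add contDiff_const
  have hD : ∀ y, fderiv ℝ (fun y => W y + ζ) y = fderiv ℝ W y := fun y => fderiv_add_const ζ
  -- the Laplacian ignores the constant (for `C²` fields)
  have hΔ : ContDiff ℝ 2 W → ∀ y, (Δ (fun y => W y + ζ)) y = (Δ W) y := by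
    intro hW y
    rw [show (fun y => W y + ζ) = W + fun _ => ζ from rfl,
      ContDiffAt.laplacian_add hW.contDiffAt contDiff_const.contDiffAt, laplacian_const_eq_zero, add_zero]
  have hdivIff : VectorCalculus.IsDivFree (fun y => W y + ζ) ↔ VectorCalculus.IsDivFree W := by
    simp only [VectorCalculus.IsDivFree, VectorCalculus.divergence, hD]
  constructor
  · intro h
    have hW : ContDiff ℝ 2 W := hsm.1 h.contDiff_velocity
    refine ⟨hW, h.contDiff_pressure, fun z => ?_, hdivIff.1 h.divFree⟩
    have hm := h.momentum z
    rw [convect, hD z, hΔ hW z, map_add, Pi.zero_apply] at hm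
    rw [← neg_eq_zero, ← hm]
    abel
  · rintro ⟨hW, hP, hR, hdiv⟩
    exact
      { contDiff_velocity := hsm.2 hW
        contDiff_pressure := hP
        momentum := fun z => by
          rw [convect, hD z, hΔ hW z, map_add, Pi.zero_apply]
          have := hR z
          rw [← neg_eq_zero, ← this]
          abel
        divFree := hdivIff.2 hdiv }

/-- **Finite NS scaling carries the drift to `μζ`** (TEMPLATE (L4): «NS scaling `W_μ(y) = μW(μy)` carries drift `μζ_∞`»):
if `W + ζ` is a steady solution then so is `μW(μ·) + μζ` with pressure `μ²P(μ·)` (the tree's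
`IsSteadyNSSolution.rescale`). [new here — dictionary] -/
theorem steadyWithDrift_rescale (h : IsSteadyNSSolution ν 0 (fun y => W y + ζ) P) (μ : ℝ) :
    IsSteadyNSSolution ν 0 (fun y => μ • W (μ • y) + μ • ζ) (fun y => μ ^ 2 * P (μ • y)) := by
  have h1 := h.rescale μ
  convert h1 using 2
  · simp
  · simp [smul_add]

/-- **Translation keeps the drift**: if `W + ζ` is a steady solution then so is `W(· + a) + ζ` with pressure `P(· + a)`
(the tree's `IsSteadyNSSolution.comp_add_right`). [new here — dictionary] -/
theorem steadyWithDrift_comp_add_right (h : IsSteadyNSSolution ν 0 (fun y => W y + ζ) P) (a : E) :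
    IsSteadyNSSolution ν 0 (fun y => W (y + a) + ζ) (fun y => P (y + a)) := by
  have h1 := h.comp_add_right a
  exact h1

/-- **The Galilean boost `W ↦ W + c` changes the drift to `ζ − c`** (TEMPLATE (L4): «Galilean boosts along the axis
map the class to itself»): `W + ζ = (W + c) + (ζ − c)`, so the two statements are the same. [new here — dictionary] -/
theorem steadyWithDrift_boost (c : E) :
    IsSteadyNSSolution ν 0 (fun y => (W y + c) + (ζ - c)) P ↔ IsSteadyNSSolution ν 0 (fun y => W y + ζ) P := by
  have : (fun y => (W y + c) + (ζ - c)) = fun y => W y + ζ := by funext y; abel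
  rw [this]

/-- **The generators from the structure.** If `W + ζ` is a steady solution with `W ∈ C³`, `P ∈ C²`, then the (L4)
identities hold: `L_W(ΛW + ζ, Λ₂P) = 0` and `L_W(∂ₕW, ∂ₕP) = 0` for every `h` (corollary of
`isSteadyNSSolution_add_const_iff` and the two generator theorems). [new here — dictionary] -/
theorem IsSteadyNSSolution.linearised_generators (h : IsSteadyNSSolution ν 0 (fun y => W y + ζ) P)
    (hW : ContDiff ℝ 3 W) (hP : ContDiff ℝ 2 P) (y hdir : E) :
    (ν • (Δ (fun z => W z + fderiv ℝ W z z + ζ)) y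
        - fderiv ℝ (fun z => W z + fderiv ℝ W z z + ζ) y ζ
        - (fderiv ℝ W y (W y + fderiv ℝ W y y + ζ) + fderiv ℝ (fun z => W z + fderiv ℝ W z z + ζ) y (W y))
        - gradient (fun z => 2 * P z + fderiv ℝ P z z) y = 0) ∧
    (ν • (Δ (fun z => fderiv ℝ W z hdir)) y
        - fderiv ℝ (fun z => fderiv ℝ W z hdir) y ζ
        - (fderiv ℝ W y (fderiv ℝ W y hdir) + fderiv ℝ (fun z => fderiv ℝ W z hdir) y (W y))
        - gradient (fun z => fderiv ℝ P z hdir) y = 0) := by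
  obtain ⟨-, -, hR, -⟩ := isSteadyNSSolution_add_const_iff.1 h
  exact ⟨linearisedSteadyNS_scalingGenerator_add_drift hW hP hR y,
    linearisedSteadyNS_translationGenerator hW hP hR y hdir⟩

end Drift

end TypeIIModulationDictionary
end Summit.NavierStokesRegularity.OSWSelfSimilar
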